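import Literature.Topology.FourManifolds.ArcClosingHomotopy
import Literature.AlgebraicTopology.FundamentalGroup.SphereCoreComplementPi1
import Literature.AlgebraicTopology.FundamentalGroup.CellAttachmentPi1
import Literature.AlgebraicTopology.Homotopy.HomotopyGroupsGeneralPosition
import Mathlib.Analysis.SpecialFunctions.Trigonometric.ArctanDeriv
import Mathlib.Analysis.Convex.Contractible
import HarnessLib

/-!
# Every element of `π₁` of a closed manifold of dimension `≥ 3` is the class of a smoothly
# embedded circle through the base point

Topic `Literature/Topology/FourManifolds` (fact seat of
`Literature.Topology.FourManifolds.isOrientedBordant_of_isEmpty_of_signature_eq_zero`, Kirby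
1989, Cor. IX.2 with VIII Thm 1(A), whose proof begins: *"First we make `M` 1-connected by adding
2-handles to `M × I` along circles"* — the circles being embedded representatives of generators
of `π₁(M)`).  The representability of classes of `π₁` by EMBEDDED circles in dimension `≥ 3` is
Whitney's theorem (H. Whitney, *Differentiable manifolds*, Ann. of Math. 37 (1936), §II Thms. 5–6;
Milnor, *Lectures on the h-cobordism theorem* (1965), Lemma 6.12 with its clause `g ≃ f`), in
the tree as the arc-closing lemma with class control
`exists_embedding_circle_through_arc_homotopic` (`ArcClosingHomotopy.lean`).  This file supplies
the two remaining elementary inputs and assembles: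

* `exists_arc_apply_zero_eq` — through every point of a manifold modelled on `ℝⁿ`, `n ≥ 1`,
  passes a `C^∞` injective immersion `γ : ℝ → V` with `γ 0 = x₀` (a straight segment in a chart,
  reparametrised over `ℝ` by `arctan`);
* `exists_path_forall_ne_mk_eq` — in a connected manifold of dimension `n ≥ 3`, every homotopy
  class of paths between two points other than `x₀` contains a path avoiding `x₀`
  (`π₁(V ∖ x₀) → π₁(V)` is onto: `bijective_inclHom_compl_core` for a Euclidean neighbourhood
  of `x₀`, and `V ∖ x₀` is path connected);
* `exists_isSmoothEmbedding_circleLoop_eq` — **for a closed connected manifold `V` of dimension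
  `n ≥ 3`, `x₀ ∈ V` and `g ∈ π₁(V, x₀)` there is a smooth embedding `e : S¹ → V` with
  `e (1, 0) = x₀` whose loop `t ↦ e (cos 2πt, sin 2πt)` has class `g`.**

Everything is proved; no definitions, no named facts.

## References

* H. Whitney, *Differentiable manifolds*, Ann. of Math. (2) 37 (1936), 645–680, §II Thms. 5–6.
  [Whitney1936]
* J. Milnor, *Lectures on the h-cobordism theorem* (1965), Lemma 6.12 (PDF p. 42), proof of
  Lemma 8.3 (PDF p. 56). [MilnorHCobordism1965]
* R. C. Kirby, *The Topology of 4-Manifolds*, LNM 1374 (1989), Ch. VIII, proof of Thm 1(A).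
  [Kirby1989]
* A. Hatcher, *Algebraic Topology* (2002), Prop. 1.5, Prop. 1.14, Lemma 1.15. [HatcherAT2002]
-/

open scoped Manifold ContDiff Topology Real
open Set Function Metric Module Filter Topology
open Literature.AlgebraicTopology.FundamentalGroup
open Literature.AlgebraicTopology.FundamentalGroup.VanKampen
open Literature.AlgebraicTopology.FundamentalGroupoid
  (isSimplyConnected_compl_singleton_of_isOpenEmbedding)
open Literature.AlgebraicTopology.Homotopy
  (exists_isOpenEmbedding_apply_zero_eq isPathConnected_compl_singleton_of_chartedSpace)

noncomputable section

namespace Literature.Topology.FourManifolds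

universe u

/-! ### Arcs through a point -/

section Arc

variable {n : ℕ} {V : Type*} [TopologicalSpace V] [ChartedSpace (EuclideanSpace ℝ (Fin n)) V]

/-- The reparametrisation `s ↦ (2δ/π) arctan s` of `ℝ` onto `(-δ, δ)`: smooth, injective,
vanishing at `0`, with image in `(-δ, δ)` and nowhere-vanishing derivative (private copy of the
lemma of `EmbeddedSubmanifoldNormalArc.lean`). [folklore] -/
private theorem arctan_reparam {δ : ℝ} (hδ : 0 < δ) :
    ∃ σ : ℝ → ℝ, ContDiff ℝ ∞ σ ∧ Injective σ ∧ σ 0 = 0 ∧ (∀ s, |σ s| < δ) ∧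
      ∃ σ' : ℝ → ℝ, (∀ s, HasDerivAt σ (σ' s) s) ∧ ∀ s, σ' s ≠ 0 := by
  refine ⟨fun s ↦ δ * (2 / π) * Real.arctan s, contDiff_const.mul Real.contDiff_arctan, ?_, ?_,
    ?_, fun s ↦ δ * (2 / π) * (1 / (1 + s ^ 2)), fun s ↦ (Real.hasDerivAt_arctan s).const_mul _,
    fun s ↦ ?_⟩
  · have hc : 0 < δ * (2 / π) := by positivity
    exact (Real.arctan_strictMono.const_mul hc).injective
  · simp
  · intro s
    have h1 := Real.arctan_lt_pi_div_two s
    have h2 := Real.neg_pi_div_two_lt_arctan s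
    have hπ := Real.pi_pos
    rw [abs_lt]
    constructor
    · have : δ * (2 / π) * (-(π / 2)) < δ * (2 / π) * Real.arctan s :=
        mul_lt_mul_of_pos_left h2 (by positivity)
      calc -δ = δ * (2 / π) * (-(π / 2)) := by field_simp
        _ < _ := this
    · have : δ * (2 / π) * Real.arctan s < δ * (2 / π) * (π / 2) :=
        mul_lt_mul_of_pos_left h1 (by positivity)
      calc _ < δ * (2 / π) * (π / 2) := this
        _ = δ := by field_simp
  · positivity

/-- **An arc through a point.**  Through every point `x₀` of a `C^∞` manifold modelled on `ℝⁿ`,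
`n ≥ 1`, there is a `C^∞` injective immersion `γ : ℝ → V` with `γ 0 = x₀`: a straight segment
`r ↦ ψ⁻¹(ψ x₀ + r v)` in the chart `ψ` at `x₀`, short enough to stay in the chart, reparametrised
over `ℝ` by `r = (2δ/π) arctan s`. [folklore] -/
theorem exists_arc_apply_zero_eq [IsManifold (𝓡 n) ∞ V] (hn : 1 ≤ n) (x₀ : V) :
    ∃ γ : ℝ → V, ContMDiff 𝓘(ℝ, ℝ) (𝓡 n) ∞ γ ∧ Injective γ ∧
      (∀ s, Injective (mfderiv 𝓘(ℝ, ℝ) (𝓡 n) γ s)) ∧ γ 0 = x₀ := by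
  -- ### the chart at `x₀` and a direction
  set ψ := chartAt (EuclideanSpace ℝ (Fin n)) x₀ with hψdef
  have hψ : ψ ∈ IsManifold.maximalAtlas (𝓡 n) ∞ V := IsManifold.chart_mem_maximalAtlas x₀
  have hx₀ψ : x₀ ∈ ψ.source := mem_chart_source _ x₀
  set c : EuclideanSpace ℝ (Fin n) := ψ.extend (𝓡 n) x₀ with hcdef
  set v : EuclideanSpace ℝ (Fin n) := EuclideanSpace.single ⟨0, hn⟩ 1 with hvdef
  have hv0 : v ≠ 0 := by
    intro h
    have := congrArg (fun w : EuclideanSpace ℝ (Fin n) => w ⟨0, hn⟩) h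
    simp [hvdef] at this
  have hT : IsOpen (ψ.extend (𝓡 n)).target := OpenPartialHomeomorph.isOpen_extend_target _
  have hcT : c ∈ (ψ.extend (𝓡 n)).target :=
    (ψ.extend (𝓡 n)).map_source (by rwa [OpenPartialHomeomorph.extend_source])
  set g : EuclideanSpace ℝ (Fin n) → V := ⇑(ψ.extend (𝓡 n)).symm with hgdef
  have hgc : g c = x₀ := OpenPartialHomeomorph.extend_left_inv _ hx₀ψ
  -- ### a short segment inside the chart
  have hlin : Continuous fun r : ℝ ↦ c + r • v :=
    continuous_const.add (continuous_id.smul continuous_const)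
  obtain ⟨δ, hδ, hδp⟩ : ∃ δ > 0, ∀ r : ℝ, |r| < δ → c + r • v ∈ (ψ.extend (𝓡 n)).target := by
    have E1 : ∀ᶠ r in 𝓝 (0 : ℝ), c + r • v ∈ (ψ.extend (𝓡 n)).target :=
      hlin.continuousAt.preimage_mem_nhds (by simpa using hT.mem_nhds hcT)
    obtain ⟨δ, hδ, hball⟩ := Metric.eventually_nhds_iff.1 E1
    exact ⟨δ, hδ, fun r hr ↦ hball (by rwa [Real.dist_0_eq_abs])⟩
  -- ### the reparametrised arc `γ s = ψ⁻¹ (c + σ s • v)`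
  obtain ⟨σ, hσs, hσinj, hσ0, hσδ, σ', hσ', hσ'0⟩ := arctan_reparam hδ
  set ℓ : ℝ → EuclideanSpace ℝ (Fin n) := fun s ↦ c + σ s • v with hℓdef
  have hℓT : ∀ s, ℓ s ∈ (ψ.extend (𝓡 n)).target := fun s ↦ hδp _ (hσδ s)
  have hℓs : ContDiff ℝ ∞ ℓ := contDiff_const.add (hσs.smul contDiff_const)
  have hℓd : ∀ s, HasDerivAt ℓ (σ' s • v) s := fun s ↦ ((hσ' s).smul_const v).const_add c
  set γ : ℝ → V := fun s ↦ g (ℓ s) with hγdef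
  have hψγ : ∀ s, ψ.extend (𝓡 n) (γ s) = ℓ s := fun s ↦ (ψ.extend (𝓡 n)).right_inv (hℓT s)
  have hγsrc : ∀ s, γ s ∈ ψ.source := fun s ↦ by
    have := (ψ.extend (𝓡 n)).map_target (hℓT s)
    rwa [OpenPartialHomeomorph.extend_source] at this
  have hcomp : (ψ.extend (𝓡 n)) ∘ γ = ℓ := funext hψγ
  -- smoothness
  have hgs : ContMDiffOn 𝓘(ℝ, EuclideanSpace ℝ (Fin n)) (𝓡 n) ∞ g (ψ.extend (𝓡 n)).target := by
    rw [OpenPartialHomeomorph.extend_target']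
    exact contMDiffOn_extend_symm hψ
  have hγ : ContMDiff 𝓘(ℝ, ℝ) (𝓡 n) ∞ γ := hgs.comp_contMDiff hℓs.contMDiff hℓT
  -- the differential of the chart along `γ`, and the chain rule `dψ ∘ dγ = dℓ`
  have hA : ∀ s, MDifferentiableAt (𝓡 n) 𝓘(ℝ, EuclideanSpace ℝ (Fin n)) (ψ.extend (𝓡 n)) (γ s) :=
    fun s ↦ ((OpenPartialHomeomorph.contMDiffOn_extend hψ).contMDiffAt
      (ψ.open_source.mem_nhds (hγsrc s))).mdifferentiableAt (by simp)
  have hchain : ∀ s, mfderiv 𝓘(ℝ, ℝ) 𝓘(ℝ, EuclideanSpace ℝ (Fin n)) ℓ s =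
      (mfderiv (𝓡 n) 𝓘(ℝ, EuclideanSpace ℝ (Fin n)) (ψ.extend (𝓡 n)) (γ s)).comp
        (mfderiv 𝓘(ℝ, ℝ) (𝓡 n) γ s) := fun s ↦ by
    rw [← hcomp]
    exact mfderiv_comp s (hA s) ((hγ s).mdifferentiableAt (by simp))
  have hℓmf : ∀ s, mfderiv 𝓘(ℝ, ℝ) 𝓘(ℝ, EuclideanSpace ℝ (Fin n)) ℓ s =
      ContinuousLinearMap.smulRight (1 : ℝ →L[ℝ] ℝ) (σ' s • v) := fun s ↦ by
    rw [mfderiv_eq_fderiv]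
    exact (hℓd s).hasFDerivAt.fderiv
  refine ⟨γ, hγ, ?_, fun s ↦ ?_, by simp [hγdef, hℓdef, hσ0, hgc]⟩
  · -- ### injectivity
    intro s s' hss'
    have h1 : ℓ s = ℓ s' := by rw [← hψγ, ← hψγ, hss']
    have h2 : σ s • v = σ s' • v := add_left_cancel h1
    exact hσinj (smul_left_injective ℝ hv0 h2)
  · -- ### immersion
    have hinjℓ : Injective (mfderiv 𝓘(ℝ, ℝ) 𝓘(ℝ, EuclideanSpace ℝ (Fin n)) ℓ s) := by
      rw [hℓmf]
      intro (a : ℝ) (b : ℝ) hab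
      have hab' : a • (σ' s • v) = b • (σ' s • v) := hab
      exact smul_left_injective ℝ (smul_ne_zero (hσ'0 s) hv0) hab'
    rw [hchain s] at hinjℓ
    have key : Injective (⇑(mfderiv (𝓡 n) 𝓘(ℝ, EuclideanSpace ℝ (Fin n)) (ψ.extend (𝓡 n)) (γ s)) ∘
        ⇑(mfderiv 𝓘(ℝ, ℝ) (𝓡 n) γ s)) := hinjℓ
    exact key.of_comp

end Arc

/-! ### Paths avoiding a point, in a prescribed class -/

section Avoid

variable {n : ℕ} {V : Type*} [TopologicalSpace V] [T2Space V]
  [ChartedSpace (EuclideanSpace ℝ (Fin n)) V]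

/-- Bijectivity of `i_* : π₁(S) → π₁(Y)` is invariant under rewriting the subset (a private
copy of `bijective_inclHom_congr` of `LinkGroupMeridians.lean`, to keep the imports light).
[folklore] -/
private theorem bijective_inclHom_congr_set {Y : Type*} [TopologicalSpace Y] {S T : Set Y}
    (e : S = T) {x : Y} (hS : x ∈ S) (hT : x ∈ T) :
    Function.Bijective (inclHom S x hS) ↔ Function.Bijective (inclHom T x hT) := by
  subst e
  exact Iff.rfl

/-- **In a connected manifold of dimension `n ≥ 3` every homotopy class of paths between two
points other than `x₀` contains a path avoiding `x₀`** (`π₁(V ∖ x₀) → π₁(V)` is onto — even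
bijective, Kosinski VI.2 / Hatcher Prop. 1.14 — and `V ∖ x₀` is path connected).
[cite: HatcherAT2002, Prop. 1.14] -/
theorem exists_path_forall_ne_mk_eq [ConnectedSpace V] (hn : 3 ≤ n) (x₀ : V) {a b : V}
    (ha : a ≠ x₀) (hb : b ≠ x₀) (q : Path.Homotopic.Quotient a b) :
    ∃ p : Path a b, (∀ t, p t ≠ x₀) ∧ Path.Homotopic.Quotient.mk p = q := by
  haveI := ChartedSpace.locallyPathConnectedSpace (EuclideanSpace ℝ (Fin n)) V
  haveI : PathConnectedSpace V := pathConnectedSpace_iff_connectedSpace.2 ‹_›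
  obtain ⟨l, rfl⟩ : ∃ l, n = l + 1 := ⟨n - 1, by omega⟩
  -- ### a Euclidean neighbourhood of `x₀`
  obtain ⟨i, hi, rfl⟩ := exists_isOpenEmbedding_apply_zero_eq (E := EuclideanSpace ℝ (Fin (l + 1))) x₀
  set φ : PUnit.{1} × EuclideanSpace ℝ (Fin (l + 1)) → V := fun z => i z.2 with hφdef
  have hφ : IsOpenEmbedding φ := hi.comp (Homeomorph.punitProd _).isOpenEmbedding
  have hS : φ '' (univ ×ˢ ({0} : Set (EuclideanSpace ℝ (Fin (l + 1))))) = {i 0} := by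
    ext x
    simp only [mem_image, mem_prod, mem_univ, true_and, mem_singleton_iff, Prod.exists, hφdef]
    constructor
    · rintro ⟨-, w, rfl, rfl⟩
      rfl
    · rintro rfl
      exact ⟨PUnit.unit, 0, rfl, rfl⟩
  -- the model and the punctured model are simply connected (`l + 1 ≥ 3`)
  haveI : ContractibleSpace (EuclideanSpace ℝ (Fin (l + 1))) :=
    RealTopologicalVectorSpace.contractibleSpace
  haveI : SimplyConnectedSpace (EuclideanSpace ℝ (Fin (l + 1))) := inferInstance
  haveI : SimplyConnectedSpace ↥(({0} : Set (EuclideanSpace ℝ (Fin (l + 1))))ᶜ) := by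
    have h := isSimplyConnected_compl_singleton_of_isOpenEmbedding
      (M := EuclideanSpace ℝ (Fin (l + 1))) (i := id) IsOpenEmbedding.id
      (by rw [finrank_euclideanSpace, Fintype.card_fin]; omega)
    exact h
  -- ### `π₁(V ∖ x₀, x₁) → π₁(V, x₁)` is onto at the point `x₁ = i y₀`
  set y₀ : EuclideanSpace ℝ (Fin (l + 1)) := EuclideanSpace.single 0 1 with hy₀def
  have hy₀ : y₀ ≠ 0 := by
    intro h
    have := congrArg (fun w : EuclideanSpace ℝ (Fin (l + 1)) => w 0) h
    simp [hy₀def] at this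
  have hx₁ : φ (PUnit.unit, y₀) ∈ ({i 0}ᶜ : Set V) := by
    intro h
    exact hy₀ (hi.injective h)
  have hbij : Function.Bijective (inclHom ({i 0}ᶜ : Set V) (φ (PUnit.unit, y₀)) hx₁) := by
    have h := bijective_inclHom_compl_core (Z := PUnit.{1}) (E := EuclideanSpace ℝ (Fin (l + 1)))
      (W := V) (φ := φ) hφ (q₀ := (PUnit.unit, y₀)) hy₀
    exact (bijective_inclHom_congr_set (congrArg compl hS) _ hx₁).1 h
  have hO : IsPathConnected ({i 0}ᶜ : Set V) :=
    isPathConnected_compl_singleton_of_chartedSpace (E := EuclideanSpace ℝ (Fin (l + 1)))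
      (by rw [finrank_euclideanSpace, Fintype.card_fin]; omega) (i 0)
  -- ### move the base point to `a`
  obtain ⟨δ, hδ⟩ := hO.joinedIn _ hx₁ a ha
  have hsurj : Function.Surjective (inclHom ({i 0}ᶜ : Set V) a ha) :=
    (surjective_inclHom_iff_of_path hx₁ ha δ hδ).1 hbij.2
  -- ### a path from `a` to `b` off `x₀`, corrected by a loop off `x₀`
  obtain ⟨p₀, hp₀⟩ := hO.joinedIn a ha b hb
  obtain ⟨c, hc⟩ := hsurj (_root_.FundamentalGroup.fromPath
    (q.trans (Path.Homotopic.Quotient.mk p₀).symm))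
  induction c using Quotient.inductionOn with
  | h ℓ =>
    have hc' : Path.Homotopic.Quotient.mk (ℓ.map continuous_subtype_val) =
        q.trans (Path.Homotopic.Quotient.mk p₀).symm := by
      have := hc
      rw [show (⟦ℓ⟧ : _root_.FundamentalGroup _ _) =
        _root_.FundamentalGroup.fromPath (Path.Homotopic.Quotient.mk ℓ) from rfl,
        inclHom_fromPath] at this
      exact this
    refine ⟨(ℓ.map continuous_subtype_val).trans p₀, fun t => ?_, ?_⟩
    · rw [Path.trans_apply]
      split_ifs with h
      · exact (ℓ _).2
      · exact hp₀ _
    · rw [Path.Homotopic.Quotient.mk_trans, hc', Path.Homotopic.Quotient.trans_assoc,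
        Path.Homotopic.Quotient.symm_trans, Path.Homotopic.Quotient.trans_refl]

end Avoid

/-! ### Classes of `π₁` as embedded circles -/

section Represent

variable {n : ℕ} {V : Type u} [TopologicalSpace V] [T2Space V] [SecondCountableTopology V]
  [CompactSpace V] [ChartedSpace (EuclideanSpace ℝ (Fin n)) V] [IsManifold (𝓡 n) ∞ V]

/-- **Every element of `π₁` of a closed connected manifold of dimension `n ≥ 3` is the class of
a smoothly embedded circle through the base point** (Whitney 1936, §II Thms. 5–6; Milnor 1965,
Lemma 6.12 with `g ≃ f`): for `g ∈ π₁(V, x₀)` there is a `C^∞` embedding `e : S¹ → V` with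
`e (1, 0) = x₀` whose loop `t ↦ e (cos 2πt, sin 2πt)` has class `g`.  Proof: close up a short
arc through `x₀` by a path in the class forced by `g` which avoids `x₀`
(`exists_path_forall_ne_mk_eq`), using the arc-closing lemma with class control
(`exists_embedding_circle_through_arc_homotopic`).
[cite: Whitney1936, §II Thms. 5–6] [cite: MilnorHCobordism1965, Lemma 6.12 (PDF p. 42)] -/
theorem exists_isSmoothEmbedding_circleLoop_eq [ConnectedSpace V] (hn : 3 ≤ n) (x₀ : V)
    (g : _root_.FundamentalGroup V x₀) :
    ∃ e : C((Metric.sphere (0 : EuclideanSpace ℝ (Fin 2)) 1), V),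
      Manifold.IsSmoothEmbedding (𝓡 1) (𝓡 n) ∞ e ∧
      ∃ h0 : x₀ = e (circlePoint 0),
        _root_.FundamentalGroup.fromPath (Path.Homotopic.Quotient.mk (e.circleLoop.cast h0 h0)) = g := by
  -- ### an arc through `x₀`
  obtain ⟨γ, hγs, hγinj, hγimm, rfl⟩ := exists_arc_apply_zero_eq (n := n) (V := V) (by omega) x₀
  have hO : IsOpen ({γ 0}ᶜ : Set V) := isOpen_compl_singleton
  have hγO : ∀ t ≠ 0, γ t ∈ ({γ 0}ᶜ : Set V) := fun t ht h => ht (hγinj h)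
  have hγc : Continuous γ := hγs.continuous
  -- the two half-arcs as paths
  set Ap : Path (γ 0) (γ 1) :=
    { toFun := fun t => γ t
      continuous_toFun := hγc.comp continuous_subtype_val
      source' := by simp
      target' := by simp } with hAp
  set Am : Path (γ (-1)) (γ 0) :=
    { toFun := fun t => γ ((t : ℝ) - 1)
      continuous_toFun := hγc.comp (continuous_subtype_val.sub continuous_const)
      source' := by simp
      target' := by simp } with hAm
  -- ### the joining path, in the class forced by `g`, avoiding `γ 0`
  have h1 : γ 1 ≠ γ 0 := fun h => one_ne_zero (hγinj h)
  have hm1 : γ (-1) ≠ γ 0 := fun h => (neg_ne_zero.2 one_ne_zero) (hγinj h)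
  obtain ⟨pth, hpth, hpq⟩ := exists_path_forall_ne_mk_eq (V := V) hn (γ 0) h1 hm1
    (((Path.Homotopic.Quotient.mk Ap).symm.trans (_root_.FundamentalGroup.toPath g)).trans
      (Path.Homotopic.Quotient.mk Am).symm)
  -- ### closing up
  obtain ⟨e, hemb, -, -, -, h0, hhom⟩ := exists_embedding_circle_through_arc_homotopic hn hO γ
    hγs hγinj hγimm hγO pth (fun t => ⟨hpth t, hpth t⟩) Ap (fun t => rfl) Am (fun t => rfl)
  refine ⟨e, hemb, h0, ?_⟩
  rw [Path.Homotopic.Quotient.eq.2 hhom, Path.Homotopic.Quotient.mk_trans,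
    Path.Homotopic.Quotient.mk_trans, hpq]
  simp only [Path.Homotopic.Quotient.trans_assoc, Path.Homotopic.Quotient.symm_trans,
    Path.Homotopic.Quotient.trans_refl]
  rw [← Path.Homotopic.Quotient.trans_assoc, Path.Homotopic.Quotient.trans_symm,
    Path.Homotopic.Quotient.refl_trans]

end Represent

end Literature.Topology.FourManifolds
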